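import Summits.QuantumFields.YangMills.Theorems.UnitScaleTiltProp7InterpErrorNearRow
import HarnessLib

/-!
# Route `UnitScaleTilt`, crux K1 «MinimiserStabilityRegPr» (stmt-QuantumFields-19200), route-R E′ path (α′), (E1-b), row (hK₂-W) — FILE 2c (ASSEMBLY):
# THE DIST-WEIGHTED LAPLACIAN ROW OF THE PINNED-BIHARMONIC INTERPOLATION ERROR —
# `min(dist(x,C), ℓ)·|Δ(φ − φ_H)(x)| ≤ C₂·ℓ·sup|Δφ|` (`d = 3`, `ℓ = L^k`, `C = range (embIter k)`, `C₂` ABSOLUTE)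

Cell `ym3-torus`, width seat `ym3-torus-px7` (gen 3), LOCATE 19200 evidence `LOCATE-HK2W-HARMONIC-px7g3.md` §2 (BULK)(ASM); FILE 1 ✓ `…InterpErrorLocalLaplaceEnergy`
(p669609), FILE 2a ✓ `…InterpErrorHarmonicLetters` (p670170), FILE 2b `…InterpErrorPinReaction`, FILE 2b′ `…InterpErrorNearRow`.  `--supports stmt-QuantumFields-19200`,
count-neutral.  THEOREMS ONLY (0 `def`, 0 `sorry`).  YM₃ on T³ is a ladder rung (R3), not the Clay problem; nothing here claims the stub, the crux, d = 4 or the gap.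

THE ROW AND ITS PLACE.  The (E1) contraction scheme of route-R E′ (★routeR-w3 g5 LOCATE-E1, scheme of record by ★★OWNER RULING g28-№3) measures the corrector `ψ` in
`‖ψ‖_X = max(sup‖ψ‖, ℓ·sup‖D_Wψ‖, ρ₃(ψ))` with the DIST-WEIGHTED third row `ρ₃(ψ) = ℓ·sup_x min(dist(x,C), ℓ)·‖Δ_Wψ(x)‖` (px4 g2's pin-cone cure, adopted
21:18:17Z: the plain `ℓ²sup‖Δ_Wψ‖` is FALSE by a factor `0.74ℓ` at the centres).  Row (hK₂) of (E1-b) is `ρ₃(LinCorr A) ≤ c₂′‖A‖_Y`, `LinCorr A = φ_A − I_H(φ_A|_C)`,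
`Δφ_A = D*A`.  THIS FILE is its flat scalar supplier: for ANY `φ` and its pinned biharmonic interpolant `φ_H`,
`min(dist(x,C), ℓ)·|Δ(φ − φ_H)(x)| ≤ C₂·ℓ·sup|Δφ|` — so `ρ₃(LinCorr A) ≤ C₂·ℓ²·sup|D*A| ≤ C₂‖A‖_Y` (the `ℓsup‖A‖` half of `‖A‖_Y` is not needed).
MECHANISM (no kernel, no Lagrange function, no moment): `Δ(φ − φ_H) = Δφ − V`, `V := Δφ_H` HARMONIC OFF THE PINS; far from the pins `V` is bounded by its local `ℓ²`
mass (flat interior mean value, FILE 2a) which is `≍ ℓ³sup|Δφ|²` (Agmon with the reciprocal weight, FILE 1); near a pin `V = (q₀∕(2c²))·G̃ + W` with the pin reaction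
`|q₀| ≲ c²ℓ·sup|Δφ|` (FILE 2b), `|W| ≲ sup|Δφ|` (FILE 2b′) and the cone `G̃ ≲ 1∕dist` killed by the weight.

WHAT IS PROVED (ns `…Theorems.Prop7InterpErrorLaplaceWeighted`; `P.d = 3`, `j = 0`, `k ≤ m + K`, `c ≠ 0`, `φ_H` = pinned interpolant of `φ` on `range (embIter k)`
biharmonic off it, `|Δφ| ≤ M`; `q := L^k∕1024`).
* §1 `mv_const_le_of_le` (numeric), ★★ `abs_laplace_interp_error_le_of_far` ((BULK): `L^k ≥ 1024`, `13q + 19 ≤ tdist(x, embIter k y)` for all `y` ⇒ `|Δ(φ−φ_H)(x)| ≤ C_b·M`),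
  ★ `abs_laplace_interp_error_le_of_small` (`L^k < 1024 ⇒ |Δ(φ−φ_H)(x)| ≤ C_s·M`).
* §2 ★★★ `min_dist_mul_abs_laplace_interp_error_le` ((hK₂-W), inf-free form): `∃ C₂ > 0, ∀ … x (δ : ℝ), (∀ y, δ ≤ tdist(x, embIter k y)) →
  min δ (L^k) · |Δ(φ − φ_H)(x)| ≤ C₂·L^k·M` — take `δ = dist(x, C)`; `C₂` depends on nothing (not on `c`, `L`, `k`, the volume);
  ★★ `weight_mul_abs_laplace_interp_error_le` — the same in the abstract-weight letters of ✓ `Prop7ExactCorrectorGaugeSockets` §4 (`w ≤ tdist(·, centres)`, `w ≤ L^k`).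
HONEST SCOPE.  Flat (`W = 1`) letters; the covariant reading (P-cov2) is the same transfer as (hK)'s and is not typed here.  This is a supplier of the (E1) knit's
X-row 3, not a statement about the crux; numerically `C₂`'s true size is ≈ 0.28 (px4 g2, kit j317943), the proved constant is astronomically larger (it carries `C_G`).

References: T. Bałaban, CMP 102 (1985) 277–309 [Balaban1985Variational] (Prop. 7 p.299); CMP 99 (1985) 75–102 [Balaban1985RegularSpaces] ((1.36) p.82);
CMP 96 (1984) 223–250 [Balaban1984PropagatorsII] ((1.9) p.226); M. Giaquinta (1983), Ch. III §2 [Giaquinta1984].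
-/

set_option autoImplicit false

noncomputable section

open scoped BigOperators

namespace Summit.QuantumFields.YangMills.Theorems.Prop7InterpErrorLaplaceWeighted

open Literature.MathematicalPhysics.QuantumFieldTheory.Balaban1983to89
open Finset
open LatticeFieldCalculus (laplace)
open B15DeterminingSets (embIter)
open B3Taylor310LocalRemainder (tdist_comm tdist_self)
open Summit.QuantumFields.YangMills.Theorems.Prop7CentreHarmonicInterpKernel (laplace_sub')
open Summit.QuantumFields.YangMills.Theorems.Prop7InterpErrorHarmonicLetters (sq_le_mul_sum_ball_of_laplace_eq_zero)
open Summit.QuantumFields.YangMills.Theorems.Prop7InterpErrorPinReaction (scales sum_ball_sq_laplace_interp_le)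
open Summit.QuantumFields.YangMills.Theorems.Prop7InterpErrorNearRow (tdist_mul_abs_laplace_interp_error_le_of_near)

variable {P : Params}

/-! ## §1 The far row (BULK) and the small-scale row -/

/-- the mean-value constant at scale `n` against `ℓ ≤ X(n+1)` (`d = 3`). [folklore] -/
theorem mv_const_le_of_le (d : ℕ) (hd : d = 3) {n ℓ X : ℝ} (hn : 0 ≤ n) (hℓ : 0 < ℓ) (h : ℓ ≤ X * (n + 1)) :
    (2 : ℝ) ^ d * (1 + 56 * (d : ℝ)) ^ d / (n + 1) ^ d ≤ 8 * 169 ^ 3 * X ^ 3 / ℓ ^ 3 := by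
  subst hd
  push_cast
  rw [div_le_div_iff₀ (by positivity) (by positivity)]
  have h1 : ℓ ^ 3 ≤ (X * (n + 1)) ^ 3 := pow_le_pow_left₀ hℓ.le h 3
  nlinarith

/-- `|u| ≤ √K·M` from `u² ≤ K·M²` (`K, M ≥ 0`). [folklore] -/
theorem abs_le_sqrt_mul {u K M : ℝ} (hK : 0 ≤ K) (hM : 0 ≤ M) (h : u ^ 2 ≤ K * M ^ 2) : |u| ≤ Real.sqrt K * M := by
  rw [← Real.sqrt_sq (abs_nonneg u), sq_abs, ← Real.sqrt_sq hM, ← Real.sqrt_mul hK]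
  exact Real.sqrt_le_sqrt h

/-- ★★ **(BULK) THE FAR ROW**: there is an absolute `C_b > 0` such that, for `L^k ≥ 1024` and every `x` with `tdist(x, embIter k y) ≥ 13(L^k∕1024) + 19` for ALL
centres `y`:  `|Δ(φ − φ_H)(x)| ≤ C_b·M`  (`V := Δφ_H` is harmonic on `{tdist(·,x) ≤ 12q + 18}` — no centre there —, FILE 2a ✓ `sq_le_mul_sum_ball_of_laplace_eq_zero`
at scale `q = L^k∕1024` and (V-loc)). [cite: Balaban1985Variational, Prop. 7 p.299; Giaquinta1984, Ch. III §2 (2.5) p.78] -/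
theorem abs_laplace_interp_error_le_of_far : ∃ Cb : ℝ, 0 < Cb ∧
    ∀ (P : Params) (_ : P.d = 3) (k : ℕ) (_ : k ≤ P.m + P.K) (c : ℝ) (_ : c ≠ 0) (_ : 1024 ≤ P.L ^ k)
      (φ φH : SiteField P 0 ℝ) (_ : ∀ x ∈ Set.range (embIter k), φH x = φ x)
      (_ : ∀ x ∉ Set.range (embIter k), laplace c (laplace c φH) x = 0) (M : ℝ) (_ : ∀ z, |laplace c φ z| ≤ M)
      (x : Site P 0) (_ : ∀ y : Site P k, 13 * (P.L ^ k / 1024) + 19 ≤ Site.tdist x (embIter k y)),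
      |laplace c (fun z => φ z - φH z) x| ≤ Cb * M := by
  obtain ⟨CV, hCV, hV⟩ := sum_ball_sq_laplace_interp_le
  refine ⟨1 + Real.sqrt (8 * 169 ^ 3 * 1024 ^ 3 * CV), by positivity, ?_⟩
  intro P hd k hk c hc hℓk φ φH hH hEL M hφ x hfar
  classical
  obtain ⟨hq1, hq2, hq3, h9, h15, h158, hn1ℓ, h11, h12, h8⟩ := scales hℓk
  set q : ℕ := P.L ^ k / 1024 with hq
  set ℓ : ℝ := (P.L : ℝ) ^ k with hℓdef
  have hℓN : ((P.L ^ k : ℕ) : ℝ) = ℓ := by push_cast; rfl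
  have hL1 : (1 : ℝ) ≤ (P.L : ℝ) := by exact_mod_cast P.L_pos
  have hℓ1 : 1 ≤ ℓ := one_le_pow₀ hL1
  have hℓ0 : 0 < ℓ := by linarith
  have hM : 0 ≤ M := (abs_nonneg _).trans (hφ x)
  have hd3 : (P.d : ℝ) = 3 := by exact_mod_cast hd
  set V : SiteField P 0 ℝ := laplace c φH with hVdef
  -- the scale `q`, the box `r = 4q + 6`, the ball of radius `12q + 18`
  set r : ℕ := 4 * q + 6 with hr4
  have hr : r = q + P.d * (q + 2) := by rw [hr4, hd]; ring
  have h2N : 2 * P.L ^ k ≤ P.sitesPerDir 0 := by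
    show 2 * P.L ^ k ≤ 2 * P.L ^ (P.m + P.K - 0)
    exact Nat.mul_le_mul_left 2 (Nat.pow_le_pow_right P.L_pos (by omega))
  have hN : 2 * r < P.sitesPerDir 0 := by rw [hr4]; omega
  have hρ : (P.d : ℝ) * r = ((12 * q + 18 : ℕ) : ℝ) := by rw [hd3, hr4]; push_cast; ring
  have hρℓ : ((12 * q + 18 : ℕ) : ℝ) ≤ ℓ := by rw [← hℓN]; exact_mod_cast h12
  -- `V` is harmonic on the ball (no centre there)
  have hVh : ∀ z, (Site.tdist z x : ℝ) ≤ ((12 * q + 18 : ℕ) : ℝ) → laplace c V z = 0 := by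
    intro z hz
    have hzC : z ∉ Set.range (embIter k) := by
      rintro ⟨y, rfl⟩
      have h1 := hfar y
      rw [tdist_comm] at hz
      have h2 : ((13 * (P.L ^ k / 1024) + 19 : ℕ) : ℝ) ≤ Site.tdist x (embIter k y) := by exact_mod_cast h1
      push_cast at hz h2
      linarith
    rw [hVdef]; exact hEL z hzC
  have hMV := sq_le_mul_sum_ball_of_laplace_eq_zero hc x V hq1 hr hN (le_of_eq hρ) hVh
  have hVsum := hV P hd k hk c hc x ((12 * q + 18 : ℕ) : ℝ) (by positivity) hρℓ φ φH hH hEL M hφ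
  have hK : (2 : ℝ) ^ P.d * (1 + 56 * (P.d : ℝ)) ^ P.d / ((q : ℝ) + 1) ^ P.d ≤ 8 * 169 ^ 3 * 1024 ^ 3 / ℓ ^ 3 :=
    mv_const_le_of_le P.d hd (Nat.cast_nonneg q) hℓ0 (by rw [← hℓN]; exact_mod_cast (by omega : P.L ^ k ≤ 1024 * (q + 1)))
  have hVx2 : V x ^ 2 ≤ (8 * 169 ^ 3 * 1024 ^ 3 * CV) * M ^ 2 := by
    calc V x ^ 2 ≤ (8 * 169 ^ 3 * 1024 ^ 3 / ℓ ^ 3) * (CV * ℓ ^ 3 * M ^ 2) :=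
          hMV.trans (mul_le_mul hK hVsum (Finset.sum_nonneg fun _ _ => sq_nonneg _) (by positivity))
      _ = (8 * 169 ^ 3 * 1024 ^ 3 * CV) * M ^ 2 * (ℓ ^ 3 / ℓ ^ 3) := by ring
      _ = (8 * 169 ^ 3 * 1024 ^ 3 * CV) * M ^ 2 := by rw [div_self (by positivity), mul_one]
  have hVx : |V x| ≤ Real.sqrt (8 * 169 ^ 3 * 1024 ^ 3 * CV) * M := abs_le_sqrt_mul (by positivity) hM hVx2
  have hex : laplace c (fun z => φ z - φH z) x = laplace c φ x - V x := by rw [laplace_sub']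
  rw [hex]
  calc |laplace c φ x - V x| ≤ |laplace c φ x| + |V x| := abs_sub _ _
    _ ≤ M + Real.sqrt (8 * 169 ^ 3 * 1024 ^ 3 * CV) * M := add_le_add (hφ x) hVx
    _ = (1 + Real.sqrt (8 * 169 ^ 3 * 1024 ^ 3 * CV)) * M := by ring

/-- ★ **THE SMALL-SCALE ROW**: there is an absolute `C_s > 0` with `|Δ(φ − φ_H)(x)| ≤ C_s·M` everywhere whenever `L^k < 1024`
(`V(x)² ≤ Σ_{tdist(z,x) ≤ 0}V² ≤ C_V·(L^k)³·M² < C_V·1024³·M²` by (V-loc) at `R = 0`). [cite: Balaban1985Variational, Prop. 7 p.299] -/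
theorem abs_laplace_interp_error_le_of_small : ∃ Cs : ℝ, 0 < Cs ∧
    ∀ (P : Params) (_ : P.d = 3) (k : ℕ) (_ : k ≤ P.m + P.K) (c : ℝ) (_ : c ≠ 0) (_ : P.L ^ k < 1024)
      (φ φH : SiteField P 0 ℝ) (_ : ∀ x ∈ Set.range (embIter k), φH x = φ x)
      (_ : ∀ x ∉ Set.range (embIter k), laplace c (laplace c φH) x = 0) (M : ℝ) (_ : ∀ z, |laplace c φ z| ≤ M) (x : Site P 0),
      |laplace c (fun z => φ z - φH z) x| ≤ Cs * M := by
  obtain ⟨CV, hCV, hV⟩ := sum_ball_sq_laplace_interp_le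
  refine ⟨1 + Real.sqrt (CV * 1024 ^ 3), by positivity, ?_⟩
  intro P hd k hk c hc hℓk φ φH hH hEL M hφ x
  classical
  set ℓ : ℝ := (P.L : ℝ) ^ k with hℓdef
  have hℓN : ((P.L ^ k : ℕ) : ℝ) = ℓ := by push_cast; rfl
  have hL1 : (1 : ℝ) ≤ (P.L : ℝ) := by exact_mod_cast P.L_pos
  have hℓ1 : 1 ≤ ℓ := one_le_pow₀ hL1
  have hℓlt : ℓ ≤ 1024 := by rw [← hℓN]; exact_mod_cast hℓk.le
  have hM : 0 ≤ M := (abs_nonneg _).trans (hφ x)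
  set V : SiteField P 0 ℝ := laplace c φH with hVdef
  have hVsum := hV P hd k hk c hc x 0 le_rfl (by linarith) φ φH hH hEL M hφ
  have hxmem : x ∈ Finset.univ.filter (fun z : Site P 0 => (Site.tdist z x : ℝ) ≤ 0) := by
    rw [Finset.mem_filter, tdist_self]; exact ⟨Finset.mem_univ _, by simp⟩
  have hVx2 : V x ^ 2 ≤ (CV * 1024 ^ 3) * M ^ 2 := by
    calc V x ^ 2 ≤ ∑ z ∈ Finset.univ.filter (fun z : Site P 0 => (Site.tdist z x : ℝ) ≤ 0), V z ^ 2 :=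
          Finset.single_le_sum (f := fun z => V z ^ 2) (fun _ _ => sq_nonneg _) hxmem
      _ ≤ CV * ℓ ^ 3 * M ^ 2 := hVsum
      _ ≤ CV * 1024 ^ 3 * M ^ 2 := by
          have : ℓ ^ 3 ≤ 1024 ^ 3 := pow_le_pow_left₀ (by linarith) hℓlt 3
          have h0 : 0 ≤ CV * M ^ 2 := by positivity
          nlinarith
      _ = (CV * 1024 ^ 3) * M ^ 2 := by ring
  have hVx : |V x| ≤ Real.sqrt (CV * 1024 ^ 3) * M := abs_le_sqrt_mul (by positivity) hM hVx2
  have hex : laplace c (fun z => φ z - φH z) x = laplace c φ x - V x := by rw [laplace_sub']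
  rw [hex]
  calc |laplace c φ x - V x| ≤ |laplace c φ x| + |V x| := abs_sub _ _
    _ ≤ M + Real.sqrt (CV * 1024 ^ 3) * M := add_le_add (hφ x) hVx
    _ = (1 + Real.sqrt (CV * 1024 ^ 3)) * M := by ring

/-! ## §2 ★★★ (hK₂-W) The dist-weighted Laplacian row -/

/-- ★★★ **(hK₂-W) THE DIST-WEIGHTED LAPLACIAN ROW OF THE PINNED-BIHARMONIC INTERPOLATION ERROR, `d = 3`.**  There is an ABSOLUTE `C₂ > 0` such that
for every record with `P.d = 3`, every `k ≤ m + K`, lattice factor `c ≠ 0`, every `φ` and every pinned interpolant `φ_H` of `φ` on the `k`-centres biharmonic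
off them, every bound `|Δφ| ≤ M`, every site `x` and every real `δ` below the `ℓ¹` torus distance from `x` to every centre:
`min δ (L^k) · |Δ(φ − φ_H)(x)| ≤ C₂·L^k·M`.
(Read with `δ = dist(x, C)`: `ℓ·min(dist(x,C), ℓ)·|Δ(φ − φ_H)(x)| ≤ C₂·ℓ²·sup|Δφ|`, i.e. `ρ₃(LinCorr A) ≤ C₂·ℓ²·sup|D*A|` for the (E1) scheme's X-row 3.)
Cases: `L^k < 1024` — the small-scale row; `L^k ≥ 1024` and some centre within `n₁ = 13(L^k∕1024) + 18` — the near row (FILE 2b′) with `min δ ℓ ≤ tdist`; else the far row.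
[cite: Balaban1985Variational, Prop. 7 p.299; Balaban1985RegularSpaces, (1.36) p.82; Balaban1984PropagatorsII, (1.9) p.226] -/
theorem min_dist_mul_abs_laplace_interp_error_le : ∃ C₂ : ℝ, 0 < C₂ ∧
    ∀ (P : Params) (_ : P.d = 3) (k : ℕ) (_ : k ≤ P.m + P.K) (c : ℝ) (_ : c ≠ 0)
      (φ φH : SiteField P 0 ℝ) (_ : ∀ x ∈ Set.range (embIter k), φH x = φ x)
      (_ : ∀ x ∉ Set.range (embIter k), laplace c (laplace c φH) x = 0) (M : ℝ) (_ : ∀ z, |laplace c φ z| ≤ M)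
      (x : Site P 0) (δ : ℝ) (_ : ∀ y : Site P k, δ ≤ (Site.tdist x (embIter k y) : ℝ)),
      min δ ((P.L : ℝ) ^ k) * |laplace c (fun z => φ z - φH z) x| ≤ C₂ * (P.L : ℝ) ^ k * M := by
  obtain ⟨Cb, hCb, hB⟩ := abs_laplace_interp_error_le_of_far
  obtain ⟨Cs, hCs, hS⟩ := abs_laplace_interp_error_le_of_small
  obtain ⟨Cp, hCp, hPn⟩ := tdist_mul_abs_laplace_interp_error_le_of_near
  refine ⟨Cb + Cs + Cp, by positivity, ?_⟩
  intro P hd k hk c hc φ φH hH hEL M hφ x δ hδ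
  set ℓ : ℝ := (P.L : ℝ) ^ k with hℓdef
  have hL1 : (1 : ℝ) ≤ (P.L : ℝ) := by exact_mod_cast P.L_pos
  have hℓ1 : 1 ≤ ℓ := one_le_pow₀ hL1
  have hℓ0 : 0 < ℓ := by linarith
  have hM : 0 ≤ M := (abs_nonneg _).trans (hφ x)
  set A : ℝ := |laplace c (fun z => φ z - φH z) x| with hA
  have hA0 : 0 ≤ A := abs_nonneg _
  have hmin : min δ ℓ * A ≤ ℓ * A := mul_le_mul_of_nonneg_right (min_le_right _ _) hA0
  by_cases hℓk : 1024 ≤ P.L ^ k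
  · by_cases hnear : ∃ y₀ : Site P k, Site.tdist x (embIter k y₀) ≤ 13 * (P.L ^ k / 1024) + 18
    · -- the near row
      obtain ⟨y₀, hy₀⟩ := hnear
      have h1 := hPn P hd k hk c hc hℓk φ φH hH hEL M hφ y₀ x hy₀
      have h2 : min δ ℓ * A ≤ (Site.tdist x (embIter k y₀) : ℝ) * A :=
        mul_le_mul_of_nonneg_right ((min_le_left _ _).trans (hδ y₀)) hA0
      calc min δ ℓ * A ≤ Cp * ℓ * M := h2.trans h1
        _ ≤ (Cb + Cs + Cp) * ℓ * M := by
            have : 0 ≤ (Cb + Cs) * ℓ * M := by positivity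
            nlinarith
    · -- the far row
      push Not at hnear
      have hfar : ∀ y : Site P k, 13 * (P.L ^ k / 1024) + 19 ≤ Site.tdist x (embIter k y) := fun y => by
        have := hnear y; omega
      have h1 := hB P hd k hk c hc hℓk φ φH hH hEL M hφ x hfar
      calc min δ ℓ * A ≤ ℓ * A := hmin
        _ ≤ ℓ * (Cb * M) := mul_le_mul_of_nonneg_left h1 hℓ0.le
        _ ≤ (Cb + Cs + Cp) * ℓ * M := by
            have : 0 ≤ (Cs + Cp) * ℓ * M := by positivity
            nlinarith
  · -- the small-scale row
    push Not at hℓk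
    have h1 := hS P hd k hk c hc hℓk φ φH hH hEL M hφ x
    calc min δ ℓ * A ≤ ℓ * A := hmin
      _ ≤ ℓ * (Cs * M) := mul_le_mul_of_nonneg_left h1 hℓ0.le
      _ ≤ (Cb + Cs + Cp) * ℓ * M := by
          have : 0 ≤ (Cb + Cp) * ℓ * M := by positivity
          nlinarith

/-- ★★ **(hK₂-W) IN THE ABSTRACT-WEIGHT CURRENCY** (the letters of ✓ `Prop7ExactCorrectorGaugeSockets` §4: a real weight `w` on sites): if
`w x ≤ tdist(x, embIter k y)` for all sites `x` and centres `y`, and `w x ≤ L^k`, then for every `x`:  `w x · |Δ(φ − φ_H)(x)| ≤ C₂·L^k·M`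
— with the knit's `w = min(dist(·,C), ℓ)` this is X-row 3's supplier `ρ₃(φ − φ_H) = ℓ·sup_x w(x)|Δ(φ − φ_H)(x)| ≤ C₂·ℓ²·sup|Δφ|`.
[cite: Balaban1985Variational, Prop. 7 p.299; Balaban1985RegularSpaces, (1.36) p.82] -/
theorem weight_mul_abs_laplace_interp_error_le : ∃ C₂ : ℝ, 0 < C₂ ∧
    ∀ (P : Params) (_ : P.d = 3) (k : ℕ) (_ : k ≤ P.m + P.K) (c : ℝ) (_ : c ≠ 0)
      (φ φH : SiteField P 0 ℝ) (_ : ∀ x ∈ Set.range (embIter k), φH x = φ x)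
      (_ : ∀ x ∉ Set.range (embIter k), laplace c (laplace c φH) x = 0) (M : ℝ) (_ : ∀ z, |laplace c φ z| ≤ M)
      (w : Site P 0 → ℝ) (_ : ∀ (x : Site P 0) (y : Site P k), w x ≤ (Site.tdist x (embIter k y) : ℝ))
      (_ : ∀ x : Site P 0, w x ≤ (P.L : ℝ) ^ k) (x : Site P 0),
      w x * |laplace c (fun z => φ z - φH z) x| ≤ C₂ * (P.L : ℝ) ^ k * M := by
  obtain ⟨C₂, hC₂, h⟩ := min_dist_mul_abs_laplace_interp_error_le
  refine ⟨C₂, hC₂, ?_⟩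
  intro P hd k hk c hc φ φH hH hEL M hφ w hwC hwℓ x
  have h1 := h P hd k hk c hc φ φH hH hEL M hφ x (w x) (hwC x)
  rwa [min_eq_left (hwℓ x)] at h1

end Summit.QuantumFields.YangMills.Theorems.Prop7InterpErrorLaplaceWeighted

end
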